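import Literature.NumberTheory.Automorphic.PairLFunctionPoles
import HarnessLib

/-!
# Arthur–Clozel (2.2) at `s = 1`: reduction to the Jacquet–Shalika continuity part and Shahidi's
non-vanishing part (proofs only)

Topic `NumberTheory/Automorphic`; namespace `Literature.NumberTheory.Automorphic`. Proof file
(theorems only: no definition, no named fact, no instance) under the named fact
`JacquetShalika1981_partialPairL_at_one_of_ne_conj` of `PairLFunctionPoles` (Arthur–Clozel,
*Simple algebras, base change, and the advanced theory of the trace formula*, Ann. of Math.
Stud. 120 (1989), Ch. 3 §2, (2.2), p. 171, at the point `s₀ = 1` for unitary cuspidal `π`, `σ` on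
`GL_n(𝔸_K)` with `π ≇ σ̃`: `L^S(s, π ⊗ σ)` has a finite **non-zero** limit as `s → 1`, `Re s > 1`).

The printed statement has two halves with two different sources, and so has every proof of it
("cf. [27(b), Prop. 3.6]. The non-vanishing part of these results is due to Shahidi [36(a)]",
loc. cit.):

* **continuity** — "the function `L^S` extends continuously to the line `Re s = 1` with `X`
  removed" (Jacquet–Shalika, *On Euler products and the classification of automorphic forms II*,
  Amer. J. Math. 103 (1981), Prop. 3.6, as quoted by Arthur–Clozel). Printed proof: the
  Rankin–Selberg integral `I(s; φ, φ', Φ) = ∫ φ φ' E(g, Φ; s, η)` of two cusp forms against a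
  mirabolic Eisenstein series is meromorphic with poles only where `π ≅ σ̃ ⊗ |det|^{iσ}` (Cogdell,
  *Analytic theory of `L`-functions for `GL_n`*, Thm. 2.2), it unfolds to `∏_v Ψ_v` with
  `Ψ_v = det(1 - t_{π,v} ⊗ t_{σ,v} q_v^{-s})⁻¹` off `S`, and the remaining local integrals
  `A(s) = ∏_{v ∈ S ∪ ∞} Ψ_v` can be made non-zero at the point in question (op. cit. §4.2:
  "division by these factors can introduce no extraneous poles"), so that `L^S = I / A` near `s₀`
  with `I`, `A` continuous at `s₀` and `A(s₀) ≠ 0`.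
* **non-vanishing** — "Moreover, it does not vanish there": F. Shahidi, *On nonvanishing of
  `L`-functions*, Bull. Amer. Math. Soc. 2 (1980), Theorem, p. 462 (`L_S(1 + it, π × π') ≠ 0` for
  all real `t`, for cuspidal `π` on `GL_n`, `π'` on `GL_m`). Printed proof (pp. 462–463): the
  `ψ`-Fourier coefficient of the Eisenstein series on `GL_{n+m}` induced from `π ⊗ π̃'` on the
  maximal parabolic is `∏_{v ∈ S} W_{s,v}(e) · L_S(1 - (n+m)s, …)⁻¹` (Casselman–Shalika), the local
  `W_{s,v}(e)` can be made non-zero, and the Eisenstein series is holomorphic on the unitary axis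
  (Langlands), so `M · L^S = 1` near `s₀` with `M = E_χ / ∏_{v ∈ S} W_{s,v}(e)` continuous at `s₀`.

Neither half is within reach of the tree (no global Rankin–Selberg integrals beyond the
definitions of `MirabolicEisensteinSeries` / `GlobalWhittakerCoefficient`, no Eisenstein series
on `GL_{n+m}` induced from cuspidal data, no Langlands spectral theory; even Jacquet–Shalika's
Lemma (5.2), `JacquetShalika1981_continuation_partialPairL_conj`, is a named fact), and under the
fact-decomposition discipline (D-0026) the halves are **not** vendored as further named facts.
Instead this file proves, once and for all, the analysis by which the two global theories will
discharge the fact, with the halves as explicit hypotheses in the tree's limit rendering: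

* `nhdsWithin_one_lt_re_neBot_of_one_le_re`: the boundary filter "`s → s₀`, `Re s > 1`" is
  non-trivial at every `s₀` with `re s₀ ≥ 1` (generalising `nhdsWithin_one_lt_re_neBot` of
  `PairLFunctionPoles` from `s₀ = 1` to the whole closed half-plane; needed at the points
  `s₀ = 1 + it` of the sibling fact `JacquetShalika1981_partialPairL_boundary_of_ne_one`);
* the glue of the continuity half, `tendsto_of_eventually_mul_eq` /
  `tendsto_partialPairL_of_local_quotient`: "`L^S · A = I` near `s₀` for `Re s > 1`, `I`, `A`
  continuous at `s₀`, `A(s₀) ≠ 0` ⟹ `L^S → I(s₀) / A(s₀)`";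
* the glue of the non-vanishing half, `ne_zero_of_tendsto_of_eventually_mul_eq_one` /
  `partialPairL_boundaryValue_ne_zero_of_local_inverse`: "`M · L^S = 1` near `s₀` for `Re s > 1`,
  `M` continuous at `s₀` ⟹ every limit value of `L^S` at `s₀` from `Re s > 1` is non-zero";
* the reduction `JacquetShalika1981_partialPairL_at_one_of_ne_conj_of_parts`: the continuity
  half (a limit `c` of `L^S(s, π ⊗ σ)` at `1` from `Re s > 1` exists, for `π ≇ σ̃`) and Shahidi's
  half at `s₀ = 1` (every such limit value is non-zero) imply the named fact literally, and
  `JacquetShalika1981_partialPairL_at_one_of_ne_conj_iff_parts`: the fact is *equivalent* to the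
  conjunction of its two halves (uniqueness of limits along the non-trivial boundary filter), so
  nothing is lost or strengthened by the decomposition;
* the composite `JacquetShalika1981_partialPairL_at_one_of_ne_conj_of_local_quotient_of_local_inverse`:
  the fact follows from a local quotient representation `L^S = I / A` at `s = 1` for `π ≇ σ̃`
  (what the Rankin–Selberg theory delivers) and a local inverse `M · L^S = 1` at `s = 1` (what the
  Langlands–Shahidi method delivers).

## References

* J. Arthur, L. Clozel, *Simple algebras, base change, and the advanced theory of the trace
  formula*, Ann. of Math. Stud. 120 (1989), Ch. 3 §2, (2.1)–(2.3), p. 171. [ArthurClozelAMS120]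
* F. Shahidi, *On nonvanishing of `L`-functions*, Bull. Amer. Math. Soc. (N.S.) 2 (1980),
  462–464, Theorem (p. 462) and outline of proof. [ShahidiBAMS1980]
* H. Jacquet, J. A. Shalika, *On Euler products and the classification of automorphic forms II*,
  Amer. J. Math. 103 (1981), 777–815, Prop. 3.6. [JacquetShalikaAJM1981II]
* J. W. Cogdell, *Analytic theory of `L`-functions for `GL_n`*, in: *An Introduction to the
  Langlands Program* (2004), Thm. 2.2, §4.2, Thm. 4.2. [CogdellAnalyticTheory2004]
-/

noncomputable section

open scoped MatrixGroups Topology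
open NumberField IsDedekindDomain MeasureTheory Filter

namespace Literature.NumberTheory.Automorphic

open AdelicGroupData

/-! ### The boundary filter at a point of `Re s ≥ 1` -/

/-- Every `s₀` with `1 ≤ re s₀` lies in the closure of the half-plane of absolute convergence
`{s | 1 < re s}` (whose closure is `{s | 1 ≤ re s}`). [folklore] -/
theorem mem_closure_one_lt_re_of_one_le_re {s₀ : ℂ} (h : 1 ≤ s₀.re) :
    s₀ ∈ closure {s : ℂ | 1 < s.re} := by
  rw [Complex.closure_setOf_lt_re]
  exact h

/-- The filter "`s → s₀`, `Re s > 1`" is non-trivial at every `s₀` with `re s₀ ≥ 1`, in particular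
at every point `1 + it` of the line `Re s = 1` (Arthur–Clozel (2.2)–(2.3)). [folklore] -/
theorem nhdsWithin_one_lt_re_neBot_of_one_le_re {s₀ : ℂ} (h : 1 ≤ s₀.re) :
    (𝓝[{s : ℂ | 1 < s.re}] s₀).NeBot :=
  mem_closure_iff_nhdsWithin_neBot.mp (mem_closure_one_lt_re_of_one_le_re h)

/-! ### Analytic glue: limits of local quotients, non-vanishing from local inverses -/

/-- **Limit of a local quotient.** If along a filter `l` one has `L · A = I` eventually, `I → i`
and `A → a ≠ 0`, then `L → i / a`. This is the last line of the continuity half of the printed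
proofs: `L^S(s) = I(s) / A(s)` near `s₀` with `I` (a Rankin–Selberg integral) and `A` (a product of
local integrals at the bad places, chosen with `A(s₀) ≠ 0`) continuous at `s₀` (Cogdell (2004),
§4.2; Jacquet–Shalika (1981), proof of Lemma (5.2)). [folklore] -/
theorem tendsto_of_eventually_mul_eq {l : Filter ℂ} {L I A : ℂ → ℂ} {i a : ℂ}
    (hI : Tendsto I l (𝓝 i)) (hA : Tendsto A l (𝓝 a)) (ha : a ≠ 0)
    (h : ∀ᶠ s in l, L s * A s = I s) : Tendsto L l (𝓝 (i / a)) := by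
  have hA0 : ∀ᶠ s in l, A s ≠ 0 := hA.eventually_ne ha
  refine (hI.div hA ha).congr' ?_
  filter_upwards [h, hA0] with s hs hs0
  rw [Pi.div_apply, ← hs, mul_div_cancel_right₀ _ hs0]

/-- **Non-vanishing from a local inverse.** If along a non-trivial filter `l` one has
`M · L = 1` eventually, `L → c` and `M → m`, then `c ≠ 0` (indeed `m c = 1`). This is the last
line of Shahidi's proof: `M = E_χ / ∏_{v ∈ S} W_{s,v}(e)` is finite on the unitary axis because the
Eisenstein series is holomorphic there, and `M · L_S = 1` (Shahidi (1980), pp. 462–463).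
[folklore] -/
theorem ne_zero_of_tendsto_of_eventually_mul_eq_one {l : Filter ℂ} [l.NeBot] {L M : ℂ → ℂ}
    {c m : ℂ} (hL : Tendsto L l (𝓝 c)) (hM : Tendsto M l (𝓝 m))
    (h : ∀ᶠ s in l, M s * L s = 1) : c ≠ 0 := by
  have h1 : Tendsto (fun s => M s * L s) l (𝓝 (m * c)) := hM.mul hL
  have h2 : Tendsto (fun s => M s * L s) l (𝓝 1) :=
    (tendsto_const_nhds (x := (1 : ℂ))).congr' (h.mono fun s hs => hs.symm)
  have hmc : m * c = 1 := tendsto_nhds_unique h1 h2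
  rintro rfl
  simp at hmc

section Glue

variable {K : Type} [Field K] [NumberField K]

/-- **The continuity half, as the Rankin–Selberg theory delivers it.** If near `s₀` the partial
`L`-function of a pair satisfies `L^S(s) · A(s) = I(s)` for `Re s > 1`, with `I`, `A` continuous at
`s₀` and `A(s₀) ≠ 0`, then `L^S(s) → I(s₀) / A(s₀)` as `s → s₀`, `Re s > 1` (Cogdell (2004), §4.2:
"division by these factors can introduce no extraneous poles"). [folklore] -/
theorem tendsto_partialPairL_of_local_quotient {S : Set (HeightOneSpectrum (𝓞 K))}
    {α β : SatakeFamily K} {s₀ : ℂ} {I A : ℂ → ℂ} (hI : ContinuousAt I s₀)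
    (hA : ContinuousAt A s₀) (ha : A s₀ ≠ 0)
    (h : ∀ᶠ s in 𝓝 s₀, 1 < s.re → partialPairL S α β s * A s = I s) :
    Tendsto (partialPairL S α β) (𝓝[{s : ℂ | 1 < s.re}] s₀) (𝓝 (I s₀ / A s₀)) := by
  refine tendsto_of_eventually_mul_eq (hI.tendsto.mono_left nhdsWithin_le_nhds)
    (hA.tendsto.mono_left nhdsWithin_le_nhds) ha ?_
  rw [eventually_nhdsWithin_iff]
  exact h

/-- **The non-vanishing half, as the Langlands–Shahidi method delivers it.** If near a point `s₀`
with `re s₀ ≥ 1` there is `M`, continuous at `s₀`, with `M(s) · L^S(s) = 1` for `Re s > 1`, then any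
limit `c` of `L^S` at `s₀` from `Re s > 1` is non-zero (Shahidi (1980), outline of proof).
[folklore] -/
theorem partialPairL_boundaryValue_ne_zero_of_local_inverse {S : Set (HeightOneSpectrum (𝓞 K))}
    {α β : SatakeFamily K} {s₀ : ℂ} (hs₀ : 1 ≤ s₀.re) {M : ℂ → ℂ} (hM : ContinuousAt M s₀)
    (h : ∀ᶠ s in 𝓝 s₀, 1 < s.re → M s * partialPairL S α β s = 1) {c : ℂ}
    (hc : Tendsto (partialPairL S α β) (𝓝[{s : ℂ | 1 < s.re}] s₀) (𝓝 c)) : c ≠ 0 := by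
  haveI := nhdsWithin_one_lt_re_neBot_of_one_le_re hs₀
  refine ne_zero_of_tendsto_of_eventually_mul_eq_one hc (hM.tendsto.mono_left nhdsWithin_le_nhds) ?_
  rw [eventually_nhdsWithin_iff]
  exact h

end Glue

/-! ### (2.2) at `s = 1` from its two printed halves -/

section Parts

variable {n : ℕ} {K : Type} [Field K] [NumberField K]
  {μ : Measure (gl n K).automorphicQuotient} [(gl n K).IsAutomorphicMeasure μ]

/-- **Arthur–Clozel (2.2) at `s = 1` for `π ≇ σ̃`, from its two printed halves.** Hypotheses, in
the tree's rendering of `PairLFunctionPoles` (same binders as the fact): `hJS`, the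
**Jacquet–Shalika continuity part** ("`L^S` extends continuously to the line `Re s = 1` with `X`
removed", Jacquet–Shalika II, Prop. 3.6, at `s₀ = 1 ∉ X`): for `π ≇ σ̃` the limit of
`L^S(s, π ⊗ σ) = partialPairL S α β s` as `s → 1`, `Re s > 1`, exists; `hSh`, **Shahidi's
non-vanishing part** ("Moreover, it does not vanish there"; Shahidi (1980), Theorem, p. 462:
`L_S(1 + it, π × π') ≠ 0`), at `t = 0` and in limit form: every limit value of `L^S(s, π ⊗ σ)` at
`1` from `Re s > 1` is non-zero. Conclusion: the named fact
`JacquetShalika1981_partialPairL_at_one_of_ne_conj`, literally.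
[cite: ArthurClozelAMS120, Ch. 3 §2 (2.2)] -/
theorem JacquetShalika1981_partialPairL_at_one_of_ne_conj_of_parts
    (hJS : ∀ (_hn : 0 < n) (_h₁ : multiplicity_one_gl n K μ) (P P' : CuspidalAutomorphicRepGL n K μ)
      (_hne : P ≠ P'.conj) {S : Set (HeightOneSpectrum (𝓞 K))} (_hS : S.Finite)
      {α β : SatakeFamily K} (_hα : IsSatakeFamilyOf P S α) (_hβ : IsSatakeFamilyOf P' S β),
      ∃ c : ℂ, Tendsto (partialPairL S α β) (𝓝[{s : ℂ | 1 < s.re}] 1) (𝓝 c))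
    (hSh : ∀ (_hn : 0 < n) (P P' : CuspidalAutomorphicRepGL n K μ)
      {S : Set (HeightOneSpectrum (𝓞 K))} (_hS : S.Finite)
      {α β : SatakeFamily K} (_hα : IsSatakeFamilyOf P S α) (_hβ : IsSatakeFamilyOf P' S β)
      (c : ℂ) (_hc : Tendsto (partialPairL S α β) (𝓝[{s : ℂ | 1 < s.re}] 1) (𝓝 c)), c ≠ 0) :
    JacquetShalika1981_partialPairL_at_one_of_ne_conj (n := n) (K := K) (μ := μ) := by
  intro hn h₁ P P' hne S hS α β hα hβ
  obtain ⟨c, hc⟩ := hJS hn h₁ P P' hne hS hα hβ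
  exact ⟨c, hSh hn P P' hS hα hβ c hc, hc⟩

/-- **Tightness of the decomposition.** The named fact (2.2) at `s = 1` is *equivalent* to the
conjunction of its continuity half and of Shahidi's half restricted to the pairs `π ≇ σ̃` it
speaks about: from the fact, any limit value of `L^S(s, π ⊗ σ)` at `1` from `Re s > 1` coincides
with the non-zero one it provides (uniqueness of limits along the non-trivial boundary filter,
`nhdsWithin_one_lt_re_neBot`). So the decomposition neither loses nor adds strength at the
point `s₀ = 1`. [folklore] -/
theorem JacquetShalika1981_partialPairL_at_one_of_ne_conj_iff_parts :
    JacquetShalika1981_partialPairL_at_one_of_ne_conj (n := n) (K := K) (μ := μ) ↔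
      ((∀ (_hn : 0 < n) (_h₁ : multiplicity_one_gl n K μ) (P P' : CuspidalAutomorphicRepGL n K μ)
        (_hne : P ≠ P'.conj) {S : Set (HeightOneSpectrum (𝓞 K))} (_hS : S.Finite)
        {α β : SatakeFamily K} (_hα : IsSatakeFamilyOf P S α) (_hβ : IsSatakeFamilyOf P' S β),
        ∃ c : ℂ, Tendsto (partialPairL S α β) (𝓝[{s : ℂ | 1 < s.re}] 1) (𝓝 c)) ∧
      (∀ (_hn : 0 < n) (_h₁ : multiplicity_one_gl n K μ) (P P' : CuspidalAutomorphicRepGL n K μ)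
        (_hne : P ≠ P'.conj) {S : Set (HeightOneSpectrum (𝓞 K))} (_hS : S.Finite)
        {α β : SatakeFamily K} (_hα : IsSatakeFamilyOf P S α) (_hβ : IsSatakeFamilyOf P' S β)
        (c : ℂ) (_hc : Tendsto (partialPairL S α β) (𝓝[{s : ℂ | 1 < s.re}] 1) (𝓝 c)), c ≠ 0)) := by
  constructor
  · intro h
    refine ⟨fun hn h₁ P P' hne S hS α β hα hβ => ?_, fun hn h₁ P P' hne S hS α β hα hβ c hc => ?_⟩
    · obtain ⟨c, -, hc⟩ := h hn h₁ P P' hne hS hα hβ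
      exact ⟨c, hc⟩
    · obtain ⟨c₀, hc₀, hlim⟩ := h hn h₁ P P' hne hS hα hβ
      rwa [tendsto_nhds_unique hc hlim]
  · rintro ⟨hJS, hSh⟩ hn h₁ P P' hne S hS α β hα hβ
    obtain ⟨c, hc⟩ := hJS hn h₁ P P' hne hS hα hβ
    exact ⟨c, hSh hn h₁ P P' hne hS hα hβ c hc, hc⟩

/-- **(2.2) at `s = 1` from a local quotient and a local inverse** — the composite of the two
pieces of glue, i.e. exactly what the global theories must hand over in the tree's terms: if for
all unitary cuspidal `π ≇ σ̃` on `GL_n(𝔸_K)` with Satake families `α`, `β` off a finite `S` there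
are `I`, `A` continuous at `1` with `A(1) ≠ 0` and `L^S · A = I` near `1` on `Re s > 1` (the
Rankin–Selberg quotient representation, Jacquet–Shalika / Cogdell (2004), §4.2), and for all
unitary cuspidal `π`, `σ` there is `M` continuous at `1` with `M · L^S = 1` near `1` on `Re s > 1`
(Shahidi's inverse `E_χ / ∏ W_{s,v}(e)`, Shahidi (1980)), then
`JacquetShalika1981_partialPairL_at_one_of_ne_conj` holds. [cite: ArthurClozelAMS120, Ch. 3 §2 (2.2)] -/
theorem JacquetShalika1981_partialPairL_at_one_of_ne_conj_of_local_quotient_of_local_inverse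
    (hRS : ∀ (_hn : 0 < n) (_h₁ : multiplicity_one_gl n K μ) (P P' : CuspidalAutomorphicRepGL n K μ)
      (_hne : P ≠ P'.conj) {S : Set (HeightOneSpectrum (𝓞 K))} (_hS : S.Finite)
      {α β : SatakeFamily K} (_hα : IsSatakeFamilyOf P S α) (_hβ : IsSatakeFamilyOf P' S β),
      ∃ I A : ℂ → ℂ, ContinuousAt I 1 ∧ ContinuousAt A 1 ∧ A 1 ≠ 0 ∧
        ∀ᶠ s in 𝓝 (1 : ℂ), 1 < s.re → partialPairL S α β s * A s = I s)
    (hLS : ∀ (_hn : 0 < n) (P P' : CuspidalAutomorphicRepGL n K μ)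
      {S : Set (HeightOneSpectrum (𝓞 K))} (_hS : S.Finite)
      {α β : SatakeFamily K} (_hα : IsSatakeFamilyOf P S α) (_hβ : IsSatakeFamilyOf P' S β),
      ∃ M : ℂ → ℂ, ContinuousAt M 1 ∧
        ∀ᶠ s in 𝓝 (1 : ℂ), 1 < s.re → M s * partialPairL S α β s = 1) :
    JacquetShalika1981_partialPairL_at_one_of_ne_conj (n := n) (K := K) (μ := μ) := by
  refine JacquetShalika1981_partialPairL_at_one_of_ne_conj_of_parts ?_ ?_
  · intro hn h₁ P P' hne S hS α β hα hβ
    obtain ⟨I, A, hI, hA, ha, h⟩ := hRS hn h₁ P P' hne hS hα hβ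
    exact ⟨_, tendsto_partialPairL_of_local_quotient hI hA ha h⟩
  · intro hn P P' S hS α β hα hβ c hc
    obtain ⟨M, hM, h⟩ := hLS hn P P' hS hα hβ
    exact partialPairL_boundaryValue_ne_zero_of_local_inverse (le_of_eq Complex.one_re.symm) hM h hc

end Parts

end Literature.NumberTheory.Automorphic
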